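import Summits.CriticalPhenomena.PercolationContinuityZ3.Theorems.Transplant.SkelFrmQuasiBParamsFaceFloorsPinSYA
import Summits.CriticalPhenomena.PercolationContinuityZ3.Theorems.Transplant.SkelFrmBParamsFaceFloorsPinSYA
import Summits.CriticalPhenomena.PercolationContinuityZ3.Theorems.Transplant.SkelFrmQuasiBParamsFaceFloorsLAdYA
import Summits.CriticalPhenomena.PercolationContinuityZ3.Theorems.Transplant.SkelFrmBParamsFaceFloorsLAdYA
import Summits.CriticalPhenomena.PercolationContinuityZ3.Theorems.Transplant.SkelFrmQuasiBParamsFaceOriginsYLA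
import Summits.CriticalPhenomena.PercolationContinuityZ3.Theorems.Transplant.SkelFrmBParamsFaceOriginsYLA
import Summits.CriticalPhenomena.PercolationContinuityZ3.Theorems.Transplant.SkelFrmQuasiBParamsFaceOriginsXA
import Summits.CriticalPhenomena.PercolationContinuityZ3.Theorems.Transplant.SkelFrmBParamsFaceOriginsXA
import Summits.CriticalPhenomena.PercolationContinuityZ3.Theorems.Transplant.SkelFrmQuasiBParamsFaceOriginsYA
import Summits.CriticalPhenomena.PercolationContinuityZ3.Theorems.Transplant.SkelFrmBParamsFaceOriginsYA
import Summits.CriticalPhenomena.PercolationContinuityZ3.Theorems.Transplant.SkelFrmQuasiBParamsFramesF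
import Summits.CriticalPhenomena.PercolationContinuityZ3.Theorems.Transplant.SkelFrmBParamsFramesF
import Summits.CriticalPhenomena.PercolationContinuityZ3.Theorems.Transplant.SkelFrmQuasiBParamsFaceFloorsClrYF
import Summits.CriticalPhenomena.PercolationContinuityZ3.Theorems.Transplant.SkelFrmBParamsFaceFloorsClrYF
import Summits.CriticalPhenomena.PercolationContinuityZ3.Theorems.Transplant.SkelFrmQuasiBParamsFaceFloorsClrYA
import Summits.CriticalPhenomena.PercolationContinuityZ3.Theorems.Transplant.SkelFrmBParamsFaceFloorsClrYA
import Summits.CriticalPhenomena.PercolationContinuityZ3.Theorems.Transplant.SkelFrmQuasiBParamsFaceFloorsFAYA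
import Summits.CriticalPhenomena.PercolationContinuityZ3.Theorems.Transplant.SkelFrmBParamsFaceFloorsFAYA
import Summits.CriticalPhenomena.PercolationContinuityZ3.Theorems.Transplant.SkelFrmQuasiBParamsFaceFloorsFBYA
import Summits.CriticalPhenomena.PercolationContinuityZ3.Theorems.Transplant.SkelFrmBParamsFaceFloorsFBYA
import Summits.CriticalPhenomena.PercolationContinuityZ3.Theorems.Transplant.SkelFrmQuasiBParamsFaceFloorsFTYA
import Summits.CriticalPhenomena.PercolationContinuityZ3.Theorems.Transplant.SkelFrmBParamsFaceFloorsFTYA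
import Summits.CriticalPhenomena.PercolationContinuityZ3.Theorems.Transplant.SkelFrmQuasiBParamsFaceFloorsLYA
import Summits.CriticalPhenomena.PercolationContinuityZ3.Theorems.Transplant.SkelFrmBParamsFaceFloorsLYA
import Summits.CriticalPhenomena.PercolationContinuityZ3.Theorems.Transplant.SkelFrmQuasiBParamsFaceFloorsQYA
import Summits.CriticalPhenomena.PercolationContinuityZ3.Theorems.Transplant.SkelFrmBParamsFaceFloorsQYA
import Summits.CriticalPhenomena.PercolationContinuityZ3.Theorems.Transplant.SkelFrmQuasiBParamsFaceFloorsZPiYA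
import Summits.CriticalPhenomena.PercolationContinuityZ3.Theorems.Transplant.SkelFrmBParamsFaceFloorsZPiYA
import Summits.CriticalPhenomena.PercolationContinuityZ3.Theorems.Transplant.SkelFrmQuasiBParamsFaceFloorsZYA
import Summits.CriticalPhenomena.PercolationContinuityZ3.Theorems.Transplant.SkelFrmBParamsFaceFloorsZYA
import Summits.CriticalPhenomena.PercolationContinuityZ3.Theorems.Transplant.SkelFrmQuasiBParamsFaceFloorsPinYA
import Summits.CriticalPhenomena.PercolationContinuityZ3.Theorems.Transplant.SkelFrmBParamsFaceFloorsPinYA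
import Summits.CriticalPhenomena.PercolationContinuityZ3.Theorems.Transplant.SkelFrmQuasiBParamsFaceCountsYA
import Summits.CriticalPhenomena.PercolationContinuityZ3.Theorems.Transplant.SkelFrmBParamsFaceCountsYA
import Summits.CriticalPhenomena.PercolationContinuityZ3.Theorems.Transplant.SkelFrmQuasiBParamsFaceCountsRangeYA
import Summits.CriticalPhenomena.PercolationContinuityZ3.Theorems.Transplant.SkelFrmBParamsFaceCountsRangeYA
import Summits.CriticalPhenomena.PercolationContinuityZ3.Theorems.Transplant.SkelFrmQuasiBParamsFaceCountsShiftYA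
import Summits.CriticalPhenomena.PercolationContinuityZ3.Theorems.Transplant.SkelFrmBParamsFaceCountsShiftYA
import Summits.CriticalPhenomena.PercolationContinuityZ3.Theorems.Transplant.SkelPhiFaceNumsYP2T
import Summits.CriticalPhenomena.PercolationContinuityZ3.Theorems.Transplant.SkelFrmQuasiBChoiceWindow
import Summits.CriticalPhenomena.PercolationContinuityZ3.Theorems.Transplant.SkelFrmBChoiceWindow
import Summits.CriticalPhenomena.PercolationContinuityZ3.Theorems.Transplant.PlanarSkeletonFrmQuasiDefs
import Summits.CriticalPhenomena.PercolationContinuityZ3.Theorems.Transplant.PlanarSkeletonFrmDefs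
import Summits.CriticalPhenomena.PercolationContinuityZ3.Theorems.Transplant.SkelPhiStepIDataNS
import Summits.CriticalPhenomena.PercolationContinuityZ3.Theorems.Transplant.SkelFrmFromBParamsFaceFloorsY2SA
import Summits.CriticalPhenomena.PercolationContinuityZ3.Theorems.Transplant.SkelFrmBParamsFaceFloorsY2SA
import Summits.CriticalPhenomena.PercolationContinuityZ3.Theorems.Transplant.SkelFrmQuasiBParamsFaceFloorsY2WA
import Summits.CriticalPhenomena.PercolationContinuityZ3.Theorems.Transplant.SkelFrmBParamsFaceFloorsY2WA
import Summits.CriticalPhenomena.PercolationContinuityZ3.Theorems.Transplant.SkelFrmQuasi1SlotTypes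
import HarnessLib
import Summits.CriticalPhenomena.PercolationContinuityZ3.Theorems.Transplant.SkelFrmBParamsFaceFloorsY2WB
/-!
# GEN-Q PORT (WAVE-Q table v0.8 section 2, row G221, U-level L23; captain R-6/R-7 2026-08-27: carrier token swap `PlanarSkeletonFrmFrom ↦ PlanarSkeletonFrmQuasi`)
# of the tree module «Transplant/SkelFrmFromBParamsFaceFloorsY2WB» (sha256 8961a6466645c348…) onto the quasi-step carrier `PlanarSkeletonFrmQuasi` (p507026): «SkelFrmQuasiBParamsFaceFloorsY2WB»

HAND HUNK (L-FLOORMAP-1 ①⑥ / L-KitS-1 reader side; G017 «SkelFrmQuasiBChoiceNums», hp-8's KitSN): R'0×45 — the (S0) kit of record at window cost `KS.NQ Φ`.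

ORIGINAL TITLE: N2 (frames-only node, OPEN) — (F) value layer under (R-44)(c): **THE ONE-SIDED y′-FACE PACKS** (tangential, last-core, clearances) (hp-8 g43)

builds on p205010 (kernel theorem, internal audit signed; external expert review pending) — nothing in this file uses p205010; NOTHING is claimed about any open node
((N3-b), the end state).  Lane `prim-bschramm`, seat `prim-bschramm-stmt` (gen 33; GEN-Q column pen; tool = captain gen-1 g4's port_genq.py R-14 --cone + p3-g30's T1 patch).  Helper file (`--supports stmt-CriticalPhenomena-4575 --as helper`).
PORT RULES (U-wave r1–r4 re-used, GEN-Q hunk classes of p3-g29 #6136): declaration order, names and proof texts are those of «SkelFrmFromBParamsFaceFloorsY2WB», byte-identical except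
(i) the carrier token `PlanarSkeletonFrmFrom ↦ PlanarSkeletonFrmQuasi` in binders, `namespace`/`end` lines and qualified names (module names `SkelFrmFrom… ↦ SkelFrmQuasi…`
in imports of already-ported rows); (ii) `Φ.step ↦ Φ.qstep` with the called Steps lemma replaced by its `…Q`/`_q` twin and the cost `Φ.M` threaded (none in this file unless
listed below); (iii) `Φ.cyl_connected ↦ Φ.cyl_reach` readers (none unless listed); (iv) graph-ball radii / window floors ×`Φ.M` (none unless listed).  Carrier-free
residents stay imported/exported from the original «SkelFrmBParamsFaceFloorsY2WB» exactly as in the FrmFrom port.  Docstrings and citations are the original's.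

-/

noncomputable section

open scoped Classical

namespace Summit.CriticalPhenomena.PercolationContinuityZ3.Theorems.Transplant

namespace PlanarSkeletonFrmQuasi

namespace NegB

open Literature.Probability.Percolation Literature.Probability.LatticeModels SimpleGraph KNCells KNLevels
open Literature.Probability.Percolation.KozmaNitzan.Cells (oth sgOf sgOf_sign stepVec_apply_fst)
open SkelConc (Consts)
open Skelφ (shearUnit shearUnit_pos yBoxLoS yBoxHiS ySLo ySHi yBnd xBoxB xSLo xSHi xBoxLoA xBoxHiA crossOffY yPrmW xCoreB xCSLo xCSHi)
open Skelφ.StepI (DataN)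
open ChainPlanar (BridgePrm)
open TwoAxis.Para (modulus)
open Neg

namespace KS

set_option maxHeartbeats 1000000 in
/-- (R-44)(c) ONE-SIDED: **THE TANGENTIAL FLOORS `FT1`–`FT6` OF THE y′-FACE AT THE ONE-SIDED COUNTS** (`yT := yL + crossOffY … (sgOf du) NrY`, `σT := 1`, `N₃ := N3WY … yT … bwY`,
`qB₃′ := qB3YA (RA′ mk)`; generic origin `yL` with `|FcA yL| ≤ 6u₀A`, `|F1cA yL| ≤ 6u₁A`). [cite: KozmaNitzan2024, §4 Lemma 12 (pp. 23–25)] -/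
theorem floorsFT_YW (κ : Consts) {V : Type} [DecidableEq V] [Countable V] {G : SimpleGraph V} [G.LocallyFinite] (Φ : PlanarSkeletonFrmQuasi G) (t : V) (p : unitInterval) (D : Skelφ.StepI.DataNS V) (g : ℕ) (f : ℕ) (mk : ℕ) (P : PCells2T) (hP : P.toPCells2 = fcellsA κ Φ t p D g f) (hN : EqNumL κ Φ t p D g f) (hκ : (hL κ Φ t p D g f).natAbs ≤ 10 * nL κ Φ t p D g f)
    (hnA : 2000 * Neg.Kq κ * (KS0.R'0N κ Φ (KS.NQ Φ) t p D mk + 2) ≤ nL κ Φ t p D g f) (hℓ : 22000 * Neg.Kq κ * (KS0.R'0N κ Φ (KS.NQ Φ) t p D mk + 2) ≤ ℓL κ Φ t p D g f)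
    (hs0 : 6 * (KS0.R'0N κ Φ (KS.NQ Φ) t p D mk : ℤ) + 11 ≤ u₀A κ Φ t p D g f) (hs1 : 6 * (KS0.R'0N κ Φ (KS.NQ Φ) t p D mk : ℤ) + 11 ≤ u₁A κ Φ t p D g f)
    (x : Site 2) (du : MDir) (hd : du.1 = 1) (j : ℕ) (hj : j < P.K) (z : Site 2) {E : ℕ} {kE : ℤ}
    (hlev1 : P.faceL 1 j - E ≤ P.lev du x z)
    (hlev2 : P.lev du x z ≤ P.faceL 1 j + E) (hE2 : (E : ℤ) ≤ 2 * (KS0.R'0N κ Φ (KS.NQ Φ) t p D mk : ℤ))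
    (hz : |z 0 - P.cenS x 0| ≤ kE) (hkE : kE ≤ 5 * (P.r 0 : ℤ))
    (hkE24 : 2 * kE + 24 * u₀A κ Φ t p D g f + 24 + 2 * (P.c 1 : ℤ) ≤ 5 * (P.r 0 : ℤ))
    (yL : Site 2) (he0 : |FcA κ Φ t p D g f yL| ≤ 5 * u₀A κ Φ t p D g f) (he1 : |F1cA κ Φ t p D g f yL| ≤ 6 * u₁A κ Φ t p D g f)
    (hTw : 7 * u₀A κ Φ t p D g f ≤ T0Y P x du z + (bwY κ Φ t p D g f)) :
    (sgOf du = 1 → ∀ k ≤ N3WY κ Φ t p D g f P (yL + Skelφ.crossOffY (nL κ Φ t p D g f) (ℓL κ Φ t p D g f) (hL κ Φ t p D g f) (vL κ Φ t p D g f) (sgOf du) (NrY κ Φ t p D g f P yL x du z)) x du z (bwY κ Φ t p D g f),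
      modulus (nL κ Φ t p D g f) (hL κ Φ t p D g f) (vL κ Φ t p D g f) (vβL κ Φ t p D g f) *
          ((5 * (P.r 1 : ℤ) + 10 * u₁A κ Φ t p D g f * (j : ℤ) + 3 - P.lev du x z) -
            F1cA κ Φ t p D g f (yL + Skelφ.crossOffY (nL κ Φ t p D g f) (ℓL κ Φ t p D g f) (hL κ Φ t p D g f) (vL κ Φ t p D g f) (sgOf du) (NrY κ Φ t p D g f P yL x du z))) ≤
        -(u₁A κ Φ t p D g f * (shearUnit (nL κ Φ t p D g f) (hL κ Φ t p D g f) : ℤ) *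
            (xBoxB (nL κ Φ t p D g f) (ℓL κ Φ t p D g f) (hL κ Φ t p D g f) (KS0.R'0N κ Φ (KS.NQ Φ) t p D mk) k + 1)) -
          modulus (nL κ Φ t p D g f) (hL κ Φ t p D g f) (vL κ Φ t p D g f) (vβL κ Φ t p D g f) + 1) ∧
    (sgOf du = 1 → ∀ k ≤ N3WY κ Φ t p D g f P (yL + Skelφ.crossOffY (nL κ Φ t p D g f) (ℓL κ Φ t p D g f) (hL κ Φ t p D g f) (vL κ Φ t p D g f) (sgOf du) (NrY κ Φ t p D g f P yL x du z)) x du z (bwY κ Φ t p D g f),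
      modulus (nL κ Φ t p D g f) (hL κ Φ t p D g f) (vL κ Φ t p D g f) (vβL κ Φ t p D g f) *
            (F1cA κ Φ t p D g f (yL + Skelφ.crossOffY (nL κ Φ t p D g f) (ℓL κ Φ t p D g f) (hL κ Φ t p D g f) (vL κ Φ t p D g f) (sgOf du) (NrY κ Φ t p D g f P yL x du z)) + 1) +
          u₁A κ Φ t p D g f * ((shearUnit (nL κ Φ t p D g f) (hL κ Φ t p D g f) : ℤ) *
              xBoxB (nL κ Φ t p D g f) (ℓL κ Φ t p D g f) (hL κ Φ t p D g f) (KS0.R'0N κ Φ (KS.NQ Φ) t p D mk) k + shearUnit (nL κ Φ t p D g f) (hL κ Φ t p D g f) - 1) ≤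
        modulus (nL κ Φ t p D g f) (hL κ Φ t p D g f) (vL κ Φ t p D g f) (vβL κ Φ t p D g f) * (25 * (P.r 1 : ℤ) - 2 - P.lev du x z)) ∧
    (sgOf du = -1 → ∀ k ≤ N3WY κ Φ t p D g f P (yL + Skelφ.crossOffY (nL κ Φ t p D g f) (ℓL κ Φ t p D g f) (hL κ Φ t p D g f) (vL κ Φ t p D g f) (sgOf du) (NrY κ Φ t p D g f P yL x du z)) x du z (bwY κ Φ t p D g f),
      modulus (nL κ Φ t p D g f) (hL κ Φ t p D g f) (vL κ Φ t p D g f) (vβL κ Φ t p D g f) *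
          ((5 * (P.r 1 : ℤ) + 10 * u₁A κ Φ t p D g f * (j : ℤ) + 3 - P.lev du x z) +
            F1cA κ Φ t p D g f (yL + Skelφ.crossOffY (nL κ Φ t p D g f) (ℓL κ Φ t p D g f) (hL κ Φ t p D g f) (vL κ Φ t p D g f) (sgOf du) (NrY κ Φ t p D g f P yL x du z)) + 1) ≤
        -(u₁A κ Φ t p D g f * ((shearUnit (nL κ Φ t p D g f) (hL κ Φ t p D g f) : ℤ) *
            xBoxB (nL κ Φ t p D g f) (ℓL κ Φ t p D g f) (hL κ Φ t p D g f) (KS0.R'0N κ Φ (KS.NQ Φ) t p D mk) k + shearUnit (nL κ Φ t p D g f) (hL κ Φ t p D g f) - 1))) ∧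
    (sgOf du = -1 → ∀ k ≤ N3WY κ Φ t p D g f P (yL + Skelφ.crossOffY (nL κ Φ t p D g f) (ℓL κ Φ t p D g f) (hL κ Φ t p D g f) (vL κ Φ t p D g f) (sgOf du) (NrY κ Φ t p D g f P yL x du z)) x du z (bwY κ Φ t p D g f),
      -(modulus (nL κ Φ t p D g f) (hL κ Φ t p D g f) (vL κ Φ t p D g f) (vβL κ Φ t p D g f) *
              F1cA κ Φ t p D g f (yL + Skelφ.crossOffY (nL κ Φ t p D g f) (ℓL κ Φ t p D g f) (hL κ Φ t p D g f) (vL κ Φ t p D g f) (sgOf du) (NrY κ Φ t p D g f P yL x du z))) +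
            u₁A κ Φ t p D g f * (shearUnit (nL κ Φ t p D g f) (hL κ Φ t p D g f) : ℤ) *
              (xBoxB (nL κ Φ t p D g f) (ℓL κ Φ t p D g f) (hL κ Φ t p D g f) (KS0.R'0N κ Φ (KS.NQ Φ) t p D mk) k + 1) +
          modulus (nL κ Φ t p D g f) (hL κ Φ t p D g f) (vL κ Φ t p D g f) (vβL κ Φ t p D g f) - 1 ≤
        modulus (nL κ Φ t p D g f) (hL κ Φ t p D g f) (vL κ Φ t p D g f) (vβL κ Φ t p D g f) * (25 * (P.r 1 : ℤ) - 2 - P.lev du x z)) ∧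
    (∀ k ≤ N3WY κ Φ t p D g f P (yL + Skelφ.crossOffY (nL κ Φ t p D g f) (ℓL κ Φ t p D g f) (hL κ Φ t p D g f) (vL κ Φ t p D g f) (sgOf du) (NrY κ Φ t p D g f P yL x du z)) x du z (bwY κ Φ t p D g f),
      (nL κ Φ t p D g f : ℤ) * modulus (nL κ Φ t p D g f) (hL κ Φ t p D g f) (vL κ Φ t p D g f) (vβL κ Φ t p D g f) *
          (-(5 * (P.r 0 : ℤ) - 4 - 3 - P.c 1 - |z 0 - P.cenS x 0|) -
            FcA κ Φ t p D g f (yL + Skelφ.crossOffY (nL κ Φ t p D g f) (ℓL κ Φ t p D g f) (hL κ Φ t p D g f) (vL κ Φ t p D g f) (sgOf du) (NrY κ Φ t p D g f P yL x du z))) ≤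
        u₀A κ Φ t p D g f * modulus (nL κ Φ t p D g f) (hL κ Φ t p D g f) (vL κ Φ t p D g f) (vβL κ Φ t p D g f) *
              xSLo (nL κ Φ t p D g f) (qB3YA κ Φ t p D g f (KS0.R'0N κ Φ (KS.NQ Φ) t p D mk)) (KS0.R'0N κ Φ (KS.NQ Φ) t p D mk) (1) k -
            u₀A κ Φ t p D g f * (nL κ Φ t p D g f : ℤ) * (shearUnit (nL κ Φ t p D g f) (hL κ Φ t p D g f) : ℤ) *
              (xBoxB (nL κ Φ t p D g f) (ℓL κ Φ t p D g f) (hL κ Φ t p D g f) (KS0.R'0N κ Φ (KS.NQ Φ) t p D mk) k + 1) -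
          u₀A κ Φ t p D g f * (nL κ Φ t p D g f : ℤ) -
          (nL κ Φ t p D g f : ℤ) * modulus (nL κ Φ t p D g f) (hL κ Φ t p D g f) (vL κ Φ t p D g f) (vβL κ Φ t p D g f)) ∧
    (∀ k ≤ N3WY κ Φ t p D g f P (yL + Skelφ.crossOffY (nL κ Φ t p D g f) (ℓL κ Φ t p D g f) (hL κ Φ t p D g f) (vL κ Φ t p D g f) (sgOf du) (NrY κ Φ t p D g f P yL x du z)) x du z (bwY κ Φ t p D g f),
      (nL κ Φ t p D g f : ℤ) * modulus (nL κ Φ t p D g f) (hL κ Φ t p D g f) (vL κ Φ t p D g f) (vβL κ Φ t p D g f) *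
            (FcA κ Φ t p D g f (yL + Skelφ.crossOffY (nL κ Φ t p D g f) (ℓL κ Φ t p D g f) (hL κ Φ t p D g f) (vL κ Φ t p D g f) (sgOf du) (NrY κ Φ t p D g f P yL x du z)) + 1) +
            u₀A κ Φ t p D g f * modulus (nL κ Φ t p D g f) (hL κ Φ t p D g f) (vL κ Φ t p D g f) (vβL κ Φ t p D g f) *
              xSHi (nL κ Φ t p D g f) (qB3YA κ Φ t p D g f (KS0.R'0N κ Φ (KS.NQ Φ) t p D mk)) (KS0.R'0N κ Φ (KS.NQ Φ) t p D mk) (1) k +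
          u₀A κ Φ t p D g f * (nL κ Φ t p D g f : ℤ) * (shearUnit (nL κ Φ t p D g f) (hL κ Φ t p D g f) : ℤ) *
            (xBoxB (nL κ Φ t p D g f) (ℓL κ Φ t p D g f) (hL κ Φ t p D g f) (KS0.R'0N κ Φ (KS.NQ Φ) t p D mk) k + 1) ≤
        (nL κ Φ t p D g f : ℤ) * modulus (nL κ Φ t p D g f) (hL κ Φ t p D g f) (vL κ Φ t p D g f) (vβL κ Φ t p D g f) *
          (5 * (P.r 0 : ℤ) - 4 - 3 - P.c 1 - |z 0 - P.cenS x 0|)) := by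
  have hσ : sgOf du = 1 ∨ sgOf du = -1 := sgOf_sign du
  have hu0 : 1 ≤ u₀A κ Φ t p D g f := (units_eqA κ Φ t p D g f).2.2.2.2.1
  have hu1 : 1 ≤ u₁A κ Φ t p D g f := (units_eqA κ Φ t p D g f).2.2.2.2.2
  have hr1 : (P.r 1 : ℤ) = 40 * (Neg.Kq κ : ℤ) * u₁A κ Φ t p D g f := by rw [(cells_of_hP κ Φ t p D g f P hP).1 1]; exact (units_eqA κ Φ t p D g f).2.2.2.1
  have hKq : 1 ≤ Neg.Kq κ := Neg.one_le_Kq κ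
  have hKq' : (1 : ℤ) ≤ (Neg.Kq κ : ℤ) := by exact_mod_cast hKq
  have hR0 : (0 : ℤ) ≤ (KS0.R'0N κ Φ (KS.NQ Φ) t p D mk : ℤ) := by positivity
  obtain ⟨hfl, hjr⟩ := faceL1_eq κ Φ t p D g f P hP j hj
  obtain ⟨hX, hNr600⟩ := NrY_range κ Φ t p D g f P hP x du hd z hj hlev1 hlev2 yL he1 (by linarith)
  obtain ⟨hT1, -⟩ := NrY_spec κ Φ t p D g f P yL x du z hX
  have hT0 := T1Y_eq P x du hd z
  have hNr' : ((NrY κ Φ t p D g f P yL x du z : ℕ) : ℤ) + 1 ≤ 600 * (Neg.Kq κ : ℤ) := by exact_mod_cast hNr600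
  have hℓ' : 22000 * (Neg.Kq κ : ℤ) * ((KS0.R'0N κ Φ (KS.NQ Φ) t p D mk : ℤ) + 2) ≤ (ℓL κ Φ t p D g f : ℤ) := by exact_mod_cast hℓ
  have hℓN : 25 * ((NrY κ Φ t p D g f P yL x du z : ℤ) + 1) + 13 ≤ (ℓL κ Φ t p D g f : ℤ) := by nlinarith
  have hD := F1cA_crossOffY_sub_abs_le κ Φ t p D g f hN hκ yL hσ (NrY κ Φ t p D g f P yL x du z)
  have hF' := FcA_crossOffY_sub_abs_le κ Φ t p D g f hN hκ yL hσ (NrY κ Φ t p D g f P yL x du z) hℓN (by linarith)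
  set FT := F1cA κ Φ t p D g f (yL + Skelφ.crossOffY (nL κ Φ t p D g f) (ℓL κ Φ t p D g f) (hL κ Φ t p D g f) (vL κ Φ t p D g f) (sgOf du) (NrY κ Φ t p D g f P yL x du z)) with hFTdef
  have he0' : |FcA κ Φ t p D g f yL| ≤ 6 * u₀A κ Φ t p D g f := by linarith
  have he6 : |FcA κ Φ t p D g f (yL + Skelφ.crossOffY (nL κ Φ t p D g f) (ℓL κ Φ t p D g f) (hL κ Φ t p D g f) (vL κ Φ t p D g f) (sgOf du) (NrY κ Φ t p D g f P yL x du z))| ≤ 6 * u₀A κ Φ t p D g f := by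
    obtain ⟨a1, a2⟩ := abs_le.1 he0; obtain ⟨b1, b2⟩ := abs_le.1 hF'; exact abs_le.2 ⟨by linarith, by linarith⟩
  have hbw2 := (bwY_eq κ Φ t p D g f).2
  have hFst : FcA κ Φ t p D g f (yL + Skelφ.crossOffY (nL κ Φ t p D g f) (ℓL κ Φ t p D g f) (hL κ Φ t p D g f) (vL κ Φ t p D g f) (sgOf du) (NrY κ Φ t p D g f P yL x du z)) + u₀A κ Φ t p D g f ≤ T0Y P x du z + (bwY κ Φ t p D g f) := by
    obtain ⟨-, a2⟩ := abs_le.1 he6; linarith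
  have hN3 := N3WY_range κ Φ t p D g f P hP (yL + Skelφ.crossOffY (nL κ Φ t p D g f) (ℓL κ Φ t p D g f) (hL κ Φ t p D g f) (vL κ Φ t p D g f) (sgOf du) (NrY κ Φ t p D g f P yL x du z)) x du hd z hz hkE he6 (by linarith) hbw2 hFst
  have hk3 : ∀ k ≤ N3WY κ Φ t p D g f P (yL + Skelφ.crossOffY (nL κ Φ t p D g f) (ℓL κ Φ t p D g f) (hL κ Φ t p D g f) (vL κ Φ t p D g f) (sgOf du) (NrY κ Φ t p D g f P yL x du z)) x du z (bwY κ Φ t p D g f), k + 1 ≤ 1000 * Neg.Kq κ := fun k hk => by omega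
  have hσT : (1 : ℤ) = 1 ∨ (1 : ℤ) = -1 := Or.inl rfl
  have htan := tanY_pos_YW κ Φ t p D g f P x du hd z _ hz hkE24 hu0 he6 (bwY κ Φ t p D g f)
  -- the along positions of the tangential origin: `|σ·F1cA yT − (20r₁ − lev)| ≤ u₁ + 2(NrY+1) + 2`
  obtain ⟨d1, d2⟩ := abs_le.1 hD
  obtain ⟨t1, t2⟩ := abs_le.1 hT1
  have hlev_lo : 5 * (P.r 1 : ℤ) + 10 * u₁A κ Φ t p D g f * ((j : ℤ) + 1) - 1 - E ≤ P.lev du x z := by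
    rw [← hfl]; exact hlev1
  have hlev_hi : P.lev du x z ≤ 5 * (P.r 1 : ℤ) + 10 * u₁A κ Φ t p D g f * ((j : ℤ) + 1) - 1 + E := by
    rw [← hfl]; exact hlev2
  have hQu : 11 * (Neg.Kq κ : ℤ) ≤ (Neg.Kq κ : ℤ) * u₁A κ Φ t p D g f := by nlinarith
  have hKu : u₁A κ Φ t p D g f ≤ (Neg.Kq κ : ℤ) * u₁A κ Φ t p D g f := le_mul_of_one_le_left (by linarith) hKq'
  clear hF' hD hX hN3 hℓN he6 hFst
  refine ⟨fun hσ1 k hk => ?_, fun hσ1 k hk => ?_, fun hσ1 k hk => ?_, fun hσ1 k hk => ?_,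
    fun k hk => FT5_YA κ Φ t p D g f P 1 mk hN hκ hnA hℓ _ x z 0 hσT (hk3 k hk) (htan k hk).1,
    fun k hk => FT6_YA κ Φ t p D g f P 1 mk hN hκ hnA hℓ _ x z 0 hσT (hk3 k hk) (htan k hk).2⟩
  · rw [hσ1, one_mul] at hT0; rw [hσ1] at d1 d2 t1 t2
    have hnear : 5 * (P.r 1 : ℤ) + 10 * u₁A κ Φ t p D g f * (j : ℤ) + 3 - P.lev du x z + 5 * u₁A κ Φ t p D g f + 1 ≤ FT := by
      linarith [d1, t1, hT0, hjr, hr1, hNr', hQu, hKu, hlev_lo, hu1, hKq', hE2, hR0]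
    exact FT1_YA κ Φ t p D g f P mk hN hκ hℓ _ (hk3 k hk) hnear
  · rw [hσ1, one_mul] at hT0; rw [hσ1] at d1 d2 t1 t2
    have hfar : FT + 5 * u₁A κ Φ t p D g f + 1 ≤ 25 * (P.r 1 : ℤ) - 2 - P.lev du x z := by
      linarith [d2, t2, hT0, hjr, hr1, hNr', hQu, hKu, hlev_hi, hu1, hKq', hE2, hR0]
    exact FT2_YA κ Φ t p D g f P mk hN hκ hℓ _ (hk3 k hk) hfar
  · rw [hσ1, neg_one_mul] at hT0; rw [hσ1] at d1 d2 t1 t2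
    have hnear : 5 * (P.r 1 : ℤ) + 10 * u₁A κ Φ t p D g f * (j : ℤ) + 3 - P.lev du x z + 5 * u₁A κ Φ t p D g f + 1 ≤ -FT := by
      linarith [d2, t2, hT0, hjr, hr1, hNr', hQu, hKu, hlev_lo, hu1, hKq', hE2, hR0]
    exact FT3_YA κ Φ t p D g f P mk hN hκ hℓ _ (hk3 k hk) hnear
  · rw [hσ1, neg_one_mul] at hT0; rw [hσ1] at d1 d2 t1 t2
    have hfar : -FT + 5 * u₁A κ Φ t p D g f + 1 ≤ 25 * (P.r 1 : ℤ) - 2 - P.lev du x z := by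
      linarith [d1, t1, hT0, hjr, hr1, hNr', hQu, hKu, hlev_hi, hu1, hKq', hE2, hR0]
    exact FT4_YA κ Φ t p D g f P mk hN hκ hℓ _ (hk3 k hk) hfar

/-- **The one-sided landing of the y′-face's tangential x-run** (count at the tangential origin `yT`): `T0Y − bwY ≤ FcA yT + u₀·(N3WY+1) ≤ T0Y + bwY`
(`N3WY_spec`, in the `((N+1 : ℕ) : ℤ)` shape the last-core rows read). [folklore] -/
theorem hT0_YW (κ : Consts) {V : Type} [DecidableEq V] [Countable V] {G : SimpleGraph V} [G.LocallyFinite] (Φ : PlanarSkeletonFrmQuasi G) (t : V) (p : unitInterval) (D : Skelφ.StepI.DataNS V) (g : ℕ) (f : ℕ) (P : PCells2T) (x : Site 2) (du : MDir) (z yT : Site 2)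
    (hbw : u₀A κ Φ t p D g f ≤ 2 * ((bwY κ Φ t p D g f) : ℤ)) (hF : FcA κ Φ t p D g f yT + u₀A κ Φ t p D g f ≤ T0Y P x du z + (bwY κ Φ t p D g f)) :
    T0Y P x du z - (bwY κ Φ t p D g f) ≤ FcA κ Φ t p D g f yT + 1 * u₀A κ Φ t p D g f * ((N3WY κ Φ t p D g f P yT x du z (bwY κ Φ t p D g f) + 1 : ℕ) : ℤ) ∧
      FcA κ Φ t p D g f yT + 1 * u₀A κ Φ t p D g f * ((N3WY κ Φ t p D g f P yT x du z (bwY κ Φ t p D g f) + 1 : ℕ) : ℤ) ≤ T0Y P x du z + (bwY κ Φ t p D g f) := by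
  obtain ⟨-, lo, hi⟩ := N3WY_spec κ Φ t p D g f P yT x du z hbw hF
  constructor <;> push_cast <;> linarith

/-- (R-44)(c) ONE-SIDED: **THE LAST-CORE FLOORS `FL1`–`FL4` OF THE y′-FACE AT THE ONE-SIDED COUNTS, window of record `small3`** (`FL1/FL2_YW` with the
window landing `hT0_YW`; `FL3/FL4_YA_gen` at the wider along window by monotonicity; generic origin `yL` with
`|FcA yL| ≤ 6u₀A`, `|F1cA yL| ≤ 6u₁A`; index form, i.e. after `rw [hd]`). [cite: KozmaNitzan2024, §4 Lemma 12 (pp. 23–25)] -/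
theorem floorsFL_YW (κ : Consts) {V : Type} [DecidableEq V] [Countable V] {G : SimpleGraph V} [G.LocallyFinite] (Φ : PlanarSkeletonFrmQuasi G) (t : V) (p : unitInterval) (D : Skelφ.StepI.DataNS V) (g : ℕ) (f : ℕ) (mk : ℕ) (P : PCells2T) (hP : P.toPCells2 = fcellsA κ Φ t p D g f) (hN : EqNumL κ Φ t p D g f) (hκ : (hL κ Φ t p D g f).natAbs ≤ 10 * nL κ Φ t p D g f)
    (hnA : 2000 * Neg.Kq κ * (KS0.R'0N κ Φ (KS.NQ Φ) t p D mk + 2) ≤ nL κ Φ t p D g f) (hℓ : 22000 * Neg.Kq κ * (KS0.R'0N κ Φ (KS.NQ Φ) t p D mk + 2) ≤ ℓL κ Φ t p D g f)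
    (hs0 : 6 * (KS0.R'0N κ Φ (KS.NQ Φ) t p D mk : ℤ) + 11 ≤ u₀A κ Φ t p D g f) (hs1 : 6 * (KS0.R'0N κ Φ (KS.NQ Φ) t p D mk : ℤ) + 11 ≤ u₁A κ Φ t p D g f)
    (x : Site 2) (du : MDir) (hd : du.1 = 1) (j : ℕ) (hj : j < P.K) (z : Site 2) {E : ℕ} {kE : ℤ}
    (hlev1 : P.faceL 1 j - E ≤ P.lev du x z)
    (hlev2 : P.lev du x z ≤ P.faceL 1 j + E) (hE2 : (E : ℤ) ≤ 2 * (KS0.R'0N κ Φ (KS.NQ Φ) t p D mk : ℤ))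
    (hz : |z 0 - P.cenS x 0| ≤ kE) (hkE : kE ≤ 5 * (P.r 0 : ℤ))
    (yL : Site 2) (he0 : |FcA κ Φ t p D g f yL| ≤ 5 * u₀A κ Φ t p D g f) (he1 : |F1cA κ Φ t p D g f yL| ≤ 6 * u₁A κ Φ t p D g f)
    (hTw : 7 * u₀A κ Φ t p D g f ≤ T0Y P x du z + (bwY κ Φ t p D g f)) :
    ((nL κ Φ t p D g f : ℤ) * modulus (nL κ Φ t p D g f) (hL κ Φ t p D g f) (vL κ Φ t p D g f) (vβL κ Φ t p D g f) *
          (P.cenS (x + stepVec du) 0 - ((NegB.BSlot.small3 κ Φ t p D g f 0 : ℕ) : ℤ) + 2 - z 0 -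
            FcA κ Φ t p D g f (yL + Skelφ.crossOffY (nL κ Φ t p D g f) (ℓL κ Φ t p D g f) (hL κ Φ t p D g f) (vL κ Φ t p D g f) (sgOf du) (NrY κ Φ t p D g f P yL x du z))) ≤
        ((P.s 0 : ℕ) : ℤ) * modulus (nL κ Φ t p D g f) (hL κ Φ t p D g f) (vL κ Φ t p D g f) (vβL κ Φ t p D g f) *
              xCSLo (nL κ Φ t p D g f) (qB3YA κ Φ t p D g f (KS0.R'0N κ Φ (KS.NQ Φ) t p D mk)) (KS0.R'0N κ Φ (KS.NQ Φ) t p D mk) (1) (N3WY κ Φ t p D g f P (yL + Skelφ.crossOffY (nL κ Φ t p D g f) (ℓL κ Φ t p D g f) (hL κ Φ t p D g f) (vL κ Φ t p D g f) (sgOf du) (NrY κ Φ t p D g f P yL x du z)) x du z (bwY κ Φ t p D g f) + 1) -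
            ((P.s 0 : ℕ) : ℤ) * (nL κ Φ t p D g f : ℤ) * (shearUnit (nL κ Φ t p D g f) (hL κ Φ t p D g f) : ℤ) *
              (xCoreB (nL κ Φ t p D g f) (ℓL κ Φ t p D g f) (hL κ Φ t p D g f) (KS0.R'0N κ Φ (KS.NQ Φ) t p D mk) (N3WY κ Φ t p D g f P (yL + Skelφ.crossOffY (nL κ Φ t p D g f) (ℓL κ Φ t p D g f) (hL κ Φ t p D g f) (vL κ Φ t p D g f) (sgOf du) (NrY κ Φ t p D g f P yL x du z)) x du z (bwY κ Φ t p D g f) + 1) + 1) -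
          ((P.s 0 : ℕ) : ℤ) * (nL κ Φ t p D g f : ℤ) -
          (nL κ Φ t p D g f : ℤ) * modulus (nL κ Φ t p D g f) (hL κ Φ t p D g f) (vL κ Φ t p D g f) (vβL κ Φ t p D g f)) ∧
    ((nL κ Φ t p D g f : ℤ) * modulus (nL κ Φ t p D g f) (hL κ Φ t p D g f) (vL κ Φ t p D g f) (vβL κ Φ t p D g f) *
            (FcA κ Φ t p D g f (yL + Skelφ.crossOffY (nL κ Φ t p D g f) (ℓL κ Φ t p D g f) (hL κ Φ t p D g f) (vL κ Φ t p D g f) (sgOf du) (NrY κ Φ t p D g f P yL x du z)) + 1) +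
            ((P.s 0 : ℕ) : ℤ) * modulus (nL κ Φ t p D g f) (hL κ Φ t p D g f) (vL κ Φ t p D g f) (vβL κ Φ t p D g f) *
              xCSHi (nL κ Φ t p D g f) (qB3YA κ Φ t p D g f (KS0.R'0N κ Φ (KS.NQ Φ) t p D mk)) (KS0.R'0N κ Φ (KS.NQ Φ) t p D mk) (1) (N3WY κ Φ t p D g f P (yL + Skelφ.crossOffY (nL κ Φ t p D g f) (ℓL κ Φ t p D g f) (hL κ Φ t p D g f) (vL κ Φ t p D g f) (sgOf du) (NrY κ Φ t p D g f P yL x du z)) x du z (bwY κ Φ t p D g f) + 1) +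
          ((P.s 0 : ℕ) : ℤ) * (nL κ Φ t p D g f : ℤ) * (shearUnit (nL κ Φ t p D g f) (hL κ Φ t p D g f) : ℤ) *
            (xCoreB (nL κ Φ t p D g f) (ℓL κ Φ t p D g f) (hL κ Φ t p D g f) (KS0.R'0N κ Φ (KS.NQ Φ) t p D mk) (N3WY κ Φ t p D g f P (yL + Skelφ.crossOffY (nL κ Φ t p D g f) (ℓL κ Φ t p D g f) (hL κ Φ t p D g f) (vL κ Φ t p D g f) (sgOf du) (NrY κ Φ t p D g f P yL x du z)) x du z (bwY κ Φ t p D g f) + 1) + 1) ≤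
        (nL κ Φ t p D g f : ℤ) * modulus (nL κ Φ t p D g f) (hL κ Φ t p D g f) (vL κ Φ t p D g f) (vβL κ Φ t p D g f) *
          (P.cenS (x + stepVec du) 0 + ((NegB.BSlot.small3 κ Φ t p D g f 0 : ℕ) : ℤ) - 2 - z 0)) ∧
    (modulus (nL κ Φ t p D g f) (hL κ Φ t p D g f) (vL κ Φ t p D g f) (vβL κ Φ t p D g f) *
          (P.cenS (x + stepVec du) 1 - ((NegB.BSlot.small3 κ Φ t p D g f 1 : ℕ) : ℤ) + 2 - z 1 -
            F1cA κ Φ t p D g f (yL + Skelφ.crossOffY (nL κ Φ t p D g f) (ℓL κ Φ t p D g f) (hL κ Φ t p D g f) (vL κ Φ t p D g f) (sgOf du) (NrY κ Φ t p D g f P yL x du z))) ≤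
        -(u₁A κ Φ t p D g f * (shearUnit (nL κ Φ t p D g f) (hL κ Φ t p D g f) : ℤ) *
            (xCoreB (nL κ Φ t p D g f) (ℓL κ Φ t p D g f) (hL κ Φ t p D g f) (KS0.R'0N κ Φ (KS.NQ Φ) t p D mk) (N3WY κ Φ t p D g f P (yL + Skelφ.crossOffY (nL κ Φ t p D g f) (ℓL κ Φ t p D g f) (hL κ Φ t p D g f) (vL κ Φ t p D g f) (sgOf du) (NrY κ Φ t p D g f P yL x du z)) x du z (bwY κ Φ t p D g f) + 1) + 1)) -
          modulus (nL κ Φ t p D g f) (hL κ Φ t p D g f) (vL κ Φ t p D g f) (vβL κ Φ t p D g f) + 1) ∧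
    (modulus (nL κ Φ t p D g f) (hL κ Φ t p D g f) (vL κ Φ t p D g f) (vβL κ Φ t p D g f) *
            (F1cA κ Φ t p D g f (yL + Skelφ.crossOffY (nL κ Φ t p D g f) (ℓL κ Φ t p D g f) (hL κ Φ t p D g f) (vL κ Φ t p D g f) (sgOf du) (NrY κ Φ t p D g f P yL x du z)) + 1) +
          u₁A κ Φ t p D g f * ((shearUnit (nL κ Φ t p D g f) (hL κ Φ t p D g f) : ℤ) *
              xCoreB (nL κ Φ t p D g f) (ℓL κ Φ t p D g f) (hL κ Φ t p D g f) (KS0.R'0N κ Φ (KS.NQ Φ) t p D mk) (N3WY κ Φ t p D g f P (yL + Skelφ.crossOffY (nL κ Φ t p D g f) (ℓL κ Φ t p D g f) (hL κ Φ t p D g f) (vL κ Φ t p D g f) (sgOf du) (NrY κ Φ t p D g f P yL x du z)) x du z (bwY κ Φ t p D g f) + 1) +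
            shearUnit (nL κ Φ t p D g f) (hL κ Φ t p D g f) - 1) ≤
        modulus (nL κ Φ t p D g f) (hL κ Φ t p D g f) (vL κ Φ t p D g f) (vβL κ Φ t p D g f) *
          (P.cenS (x + stepVec du) 1 + ((NegB.BSlot.small3 κ Φ t p D g f 1 : ℕ) : ℤ) - 2 - z 1)) := by
  have hu1 : 1 ≤ u₁A κ Φ t p D g f := (units_eqA κ Φ t p D g f).2.2.2.2.2
  have hu0 : 1 ≤ u₀A κ Φ t p D g f := (units_eqA κ Φ t p D g f).2.2.2.2.1
  have hR0 : (0 : ℤ) ≤ (KS0.R'0N κ Φ (KS.NQ Φ) t p D mk : ℤ) := by positivity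
  have hEu : (E : ℤ) ≤ 2 * u₁A κ Φ t p D g f := by linarith
  have hσ : sgOf du = 1 ∨ sgOf du = -1 := sgOf_sign du
  -- the tangential origin's drift and the forward start
  obtain ⟨-, hNr600⟩ := NrY_range κ Φ t p D g f P hP x du hd z hj hlev1 hlev2 yL he1 (by linarith)
  have hNr' : ((NrY κ Φ t p D g f P yL x du z : ℕ) : ℤ) + 1 ≤ 600 * (Neg.Kq κ : ℤ) := by exact_mod_cast hNr600
  have hℓ' : 22000 * (Neg.Kq κ : ℤ) * ((KS0.R'0N κ Φ (KS.NQ Φ) t p D mk : ℤ) + 2) ≤ (ℓL κ Φ t p D g f : ℤ) := by exact_mod_cast hℓ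
  have hℓN : 25 * ((NrY κ Φ t p D g f P yL x du z : ℤ) + 1) + 13 ≤ (ℓL κ Φ t p D g f : ℤ) := by nlinarith
  have he0' : |FcA κ Φ t p D g f yL| ≤ 6 * u₀A κ Φ t p D g f := by linarith
  have hF := FcA_crossOffY_sub_abs_le κ Φ t p D g f hN hκ yL hσ (NrY κ Φ t p D g f P yL x du z) hℓN (by linarith)
  have he6 : |FcA κ Φ t p D g f (yL + Skelφ.crossOffY (nL κ Φ t p D g f) (ℓL κ Φ t p D g f) (hL κ Φ t p D g f) (vL κ Φ t p D g f) (sgOf du) (NrY κ Φ t p D g f P yL x du z))| ≤ 6 * u₀A κ Φ t p D g f := by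
    obtain ⟨a1, a2⟩ := abs_le.1 he0; obtain ⟨b1, b2⟩ := abs_le.1 hF; exact abs_le.2 ⟨by linarith, by linarith⟩
  have hbw2 := (bwY_eq κ Φ t p D g f).2
  have hFst : FcA κ Φ t p D g f (yL + Skelφ.crossOffY (nL κ Φ t p D g f) (ℓL κ Φ t p D g f) (hL κ Φ t p D g f) (vL κ Φ t p D g f) (sgOf du) (NrY κ Φ t p D g f P yL x du z)) + u₀A κ Φ t p D g f ≤ T0Y P x du z + (bwY κ Φ t p D g f) := by
    obtain ⟨-, a2⟩ := abs_le.1 he6; linarith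
  have hN3 := N3WY_range κ Φ t p D g f P hP (yL + Skelφ.crossOffY (nL κ Φ t p D g f) (ℓL κ Φ t p D g f) (hL κ Φ t p D g f) (vL κ Φ t p D g f) (sgOf du) (NrY κ Φ t p D g f P yL x du z)) x du hd z hz hkE he6 (by linarith) hbw2 hFst
  obtain ⟨hq3, hℓk⟩ := hq3_hℓk_YA κ Φ t p D g f mk hnA hℓ hN3
  obtain ⟨hlo, hhi⟩ := hT0_YW κ Φ t p D g f P x du z (yL + Skelφ.crossOffY (nL κ Φ t p D g f) (ℓL κ Φ t p D g f) (hL κ Φ t p D g f) (vL κ Φ t p D g f) (sgOf du) (NrY κ Φ t p D g f P yL x du z)) hbw2 hFst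
  have hT1 := hT1_YA κ Φ t p D g f mk P hP hN hκ hℓ x du hd j hj z hlev1 hlev2 hEu yL he1
  -- the along window is the wider `small3 1 ≥ small 1` (monotone)
  have hsm1 : ((NegB.BSlot.small κ Φ t p D g f 1 : ℕ) : ℤ) ≤ ((NegB.BSlot.small3 κ Φ t p D g f 1 : ℕ) : ℤ) := by
    rw [(NegB.small_eq κ Φ t p D g f).2, (NegB.small3_eq κ Φ t p D g f).2]; push_cast; linarith [Nat.cast_nonneg (α := ℤ) ((fcellsA κ Φ t p D g f).s 1)]
  obtain ⟨hn1, hℓ1⟩ := one_le_of_eqNumL κ Φ t p D g f hN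
  have hm0 : (0 : ℤ) ≤ modulus (nL κ Φ t p D g f) (hL κ Φ t p D g f) (vL κ Φ t p D g f) (vβL κ Φ t p D g f) := (Skelφ.NegPrm.modulus_vβOf_pos hn1 hℓ1 _ _).le
  have h3 := FL3_YA_gen κ Φ t p D mk g f P hN hκ x du z _ hT1 hℓk
  have h4 := FL4_YA_gen κ Φ t p D mk g f P hN hκ x du z _ hT1 hℓk
  refine ⟨FL1_YW κ Φ t p D mk g f P hP hN hκ x du z _ hlo hq3 hℓk hs0, FL2_YW κ Φ t p D mk g f P hP hN hκ x du z _ hhi hq3 hℓk hs0, ?_, ?_⟩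
  · exact le_trans (mul_le_mul_of_nonneg_left (by linarith) hm0) h3
  · exact le_trans h4 (mul_le_mul_of_nonneg_left (by linarith) hm0)

/-- **M3 y′-face field `hclr₃` at hp-8's counts** (`FloorsY2.hclr₃`, `σT := σTY`, `N₃ := N3Y`, `Nr := NrY`; `qB₃′` generic): every region of the
tangential x-run is clear of the seed box by LEVEL. [cite: KozmaNitzan2024, §4 Lemma 12 (pp. 23–25)] [cite: MartineauTassion2017, §4.3 Lemma 4.2] -/
theorem hclr₃_YW (κ : Consts) {V : Type} [DecidableEq V] [Countable V] {G : SimpleGraph V} [G.LocallyFinite] (Φ : PlanarSkeletonFrmQuasi G) (t : V) (p : unitInterval) (D : Skelφ.StepI.DataNS V) (mk : ℕ) (g : ℕ) (f : ℕ) (P : PCells2T) (hP : P.toPCells2 = fcellsA κ Φ t p D g f) (hN : EqNumL κ Φ t p D g f) (hκ : (hL κ Φ t p D g f).natAbs ≤ 10 * nL κ Φ t p D g f)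
    (hℓA : 22000 * Neg.Kq κ * (KS0.R'0N κ Φ (KS.NQ Φ) t p D mk + 2) ≤ ℓL κ Φ t p D g f)
    (x : Site 2) (du : MDir) (hd : du.1 = 1) (j : ℕ) (hj : j < P.K) (z : Site 2) {E : ℕ} {kE : ℤ}
    (hlev1 : P.faceL 1 j - E ≤ P.lev du x z) (hlev2 : P.lev du x z ≤ P.faceL 1 j + E)
    (hz : |z 0 - P.cenS x 0| ≤ kE) (hEu : (E : ℤ) ≤ u₁A κ Φ t p D g f) (hkE : kE ≤ 5 * (P.r 0 : ℤ))
    (yL : Site 2) (he0 : |FcA κ Φ t p D g f yL| ≤ 5 * u₀A κ Φ t p D g f) (he1 : |F1cA κ Φ t p D g f yL| ≤ 6 * u₁A κ Φ t p D g f)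
    (hs0 : 6 * (KS0.R'0N κ Φ (KS.NQ Φ) t p D mk : ℤ) + 11 ≤ u₀A κ Φ t p D g f) (hTw : 7 * u₀A κ Φ t p D g f ≤ T0Y P x du z + (bwY κ Φ t p D g f)) (qB₃ : ℕ) :
    ∀ k ≤ N3WY κ Φ t p D g f P (yL + Skelφ.crossOffY (nL κ Φ t p D g f) (ℓL κ Φ t p D g f) (hL κ Φ t p D g f) (vL κ Φ t p D g f) (sgOf du) (NrY κ Φ t p D g f P yL x du z)) x du z (bwY κ Φ t p D g f),
      (∀ b : ℤ, min (1 * xBoxLoA (nL κ Φ t p D g f) qB₃ (KS0.R'0N κ Φ (KS.NQ Φ) t p D mk) k) (1 * xBoxHiA (nL κ Φ t p D g f) qB₃ (KS0.R'0N κ Φ (KS.NQ Φ) t p D mk) k) ≤ b →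
        b ≤ max (1 * xBoxLoA (nL κ Φ t p D g f) qB₃ (KS0.R'0N κ Φ (KS.NQ Φ) t p D mk) k) (1 * xBoxHiA (nL κ Φ t p D g f) qB₃ (KS0.R'0N κ Φ (KS.NQ Φ) t p D mk) k) →
        ((Mu D : ℕ) : ℤ) < |b + (yL + crossOffY (nL κ Φ t p D g f) (ℓL κ Φ t p D g f) (hL κ Φ t p D g f) (vL κ Φ t p D g f) (sgOf du) (NrY κ Φ t p D g f P yL x du z)) 0|) ∨
      ((shearUnit (nL κ Φ t p D g f) (hL κ Φ t p D g f) : ℤ) * (Mu D) +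
          (shearUnit (nL κ Φ t p D g f) (hL κ Φ t p D g f) : ℤ) * (xBoxB (nL κ Φ t p D g f) (ℓL κ Φ t p D g f) (hL κ Φ t p D g f) (KS0.R'0N κ Φ (KS.NQ Φ) t p D mk) k + 1) ≤
        |(nL κ Φ t p D g f : ℤ) * (yL + crossOffY (nL κ Φ t p D g f) (ℓL κ Φ t p D g f) (hL κ Φ t p D g f) (vL κ Φ t p D g f) (sgOf du) (NrY κ Φ t p D g f P yL x du z)) 1 -
          hL κ Φ t p D g f * (yL + crossOffY (nL κ Φ t p D g f) (ℓL κ Φ t p D g f) (hL κ Φ t p D g f) (vL κ Φ t p D g f) (sgOf du) (NrY κ Φ t p D g f P yL x du z)) 0|) := by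
  have hu0 : 1 ≤ u₀A κ Φ t p D g f := (units_eqA κ Φ t p D g f).2.2.2.2.1
  have hu1 : 1 ≤ u₁A κ Φ t p D g f := (units_eqA κ Φ t p D g f).2.2.2.2.2
  have hNr := clr_NrY_lb κ Φ t p D g f P hP x du hd z hj hlev1 hlev2 yL he1 (by linarith)
  have hσ : sgOf du = 1 ∨ sgOf du = -1 := sgOf_sign du
  have hR0 : (0 : ℤ) ≤ (KS0.R'0N κ Φ (KS.NQ Φ) t p D mk : ℤ) := by positivity
  obtain ⟨-, hNr600⟩ := NrY_range κ Φ t p D g f P hP x du hd z hj hlev1 hlev2 yL he1 (by linarith)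
  have hNr'' : ((NrY κ Φ t p D g f P yL x du z : ℕ) : ℤ) + 1 ≤ 600 * (Neg.Kq κ : ℤ) := by exact_mod_cast hNr600
  have hℓ'' : 22000 * (Neg.Kq κ : ℤ) * ((KS0.R'0N κ Φ (KS.NQ Φ) t p D mk : ℤ) + 2) ≤ (ℓL κ Φ t p D g f : ℤ) := by exact_mod_cast hℓA
  have hℓN : 25 * ((NrY κ Φ t p D g f P yL x du z : ℤ) + 1) + 13 ≤ (ℓL κ Φ t p D g f : ℤ) := by nlinarith
  have he0' : |FcA κ Φ t p D g f yL| ≤ 6 * u₀A κ Φ t p D g f := by linarith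
  have hF := FcA_crossOffY_sub_abs_le κ Φ t p D g f hN hκ yL hσ (NrY κ Φ t p D g f P yL x du z) hℓN (by linarith)
  have he6 : |FcA κ Φ t p D g f (yL + Skelφ.crossOffY (nL κ Φ t p D g f) (ℓL κ Φ t p D g f) (hL κ Φ t p D g f) (vL κ Φ t p D g f) (sgOf du) (NrY κ Φ t p D g f P yL x du z))| ≤ 6 * u₀A κ Φ t p D g f := by
    obtain ⟨a1, a2⟩ := abs_le.1 he0; obtain ⟨b1, b2⟩ := abs_le.1 hF; exact abs_le.2 ⟨by linarith, by linarith⟩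
  have hbw2 := (bwY_eq κ Φ t p D g f).2
  have hFst : FcA κ Φ t p D g f (yL + Skelφ.crossOffY (nL κ Φ t p D g f) (ℓL κ Φ t p D g f) (hL κ Φ t p D g f) (vL κ Φ t p D g f) (sgOf du) (NrY κ Φ t p D g f P yL x du z)) + u₀A κ Φ t p D g f ≤ T0Y P x du z + (bwY κ Φ t p D g f) := by
    obtain ⟨-, a2⟩ := abs_le.1 he6; linarith
  have hN3 := N3WY_range κ Φ t p D g f P hP (yL + Skelφ.crossOffY (nL κ Φ t p D g f) (ℓL κ Φ t p D g f) (hL κ Φ t p D g f) (vL κ Φ t p D g f) (sgOf du) (NrY κ Φ t p D g f P yL x du z)) x du hd z hz hkE he6 (by linarith) hbw2 hFst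
  have hNr' : 13 ≤ NrY κ Φ t p D g f P yL x du z := by
    have hq : (1 : ℤ) ≤ (Neg.Kq κ : ℤ) := by exact_mod_cast Neg.one_le_Kq κ
    have : (13 : ℤ) ≤ (NrY κ Φ t p D g f P yL x du z : ℤ) := by linarith
    exact_mod_cast this
  have hN3' : N3WY κ Φ t p D g f P (yL + Skelφ.crossOffY (nL κ Φ t p D g f) (ℓL κ Φ t p D g f) (hL κ Φ t p D g f) (vL κ Φ t p D g f) (sgOf du) (NrY κ Φ t p D g f P yL x du z)) x du z (bwY κ Φ t p D g f) + 2 ≤ 2000 * Neg.Kq κ := by have := Neg.one_le_Kq κ; omega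
  exact hclr₃_YA_gen κ Φ t p D mk g f hN hκ hℓA du yL (by linarith) hNr' hN3' 1 qB₃

/-- **M3 y′-face field `hπ3Y` at hp-8's counts** (`Nr := NrY`, `N₃ := N3Y`; `r` generic with `hr`). [cite: KozmaNitzan2024, §4 Lemma 12 (pp. 23–25)] -/
theorem hπ3Y_YW (κ : Consts) {V : Type} [DecidableEq V] [Countable V] {G : SimpleGraph V} [G.LocallyFinite] (Φ : PlanarSkeletonFrmQuasi G) (t : V) (p : unitInterval) (D : Skelφ.StepI.DataNS V) (c : ℕ) (mk : ℕ) (g : ℕ) (f : ℕ) (P : PCells2T) (hP : P.toPCells2 = fcellsA κ Φ t p D g f) (hN : EqNumL κ Φ t p D g f) (hκ : (hL κ Φ t p D g f).natAbs ≤ 10 * nL κ Φ t p D g f)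
    (hℓA : 22000 * Neg.Kq κ * (KS0.R'0N κ Φ (KS.NQ Φ) t p D mk + 2) ≤ ℓL κ Φ t p D g f)
    (x : Site 2) (du : MDir) (hd : du.1 = 1) (j : ℕ) (hj : j < P.K) (z : Site 2) {E : ℕ} {kE : ℤ}
    (hlev1 : P.faceL 1 j - E ≤ P.lev du x z) (hlev2 : P.lev du x z ≤ P.faceL 1 j + E)
    (hz : |z 0 - P.cenS x 0| ≤ kE) (hEu : (E : ℤ) ≤ u₁A κ Φ t p D g f) (hkE : kE ≤ 5 * (P.r 0 : ℤ))
    (yL : Site 2) (he0 : |FcA κ Φ t p D g f yL| ≤ 5 * u₀A κ Φ t p D g f) (he1 : |F1cA κ Φ t p D g f yL| ≤ 6 * u₁A κ Φ t p D g f)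
    (hs0 : 6 * (KS0.R'0N κ Φ (KS.NQ Φ) t p D mk : ℤ) + 11 ≤ u₀A κ Φ t p D g f) (hTw : 7 * u₀A κ Φ t p D g f ≤ T0Y P x du z + (bwY κ Φ t p D g f))
    (hyl : (yL 0).natAbs + (yL 1).natAbs ≤ YbF κ Φ t p D c mk g f + 11 * nL κ Φ t p D g f) (r : ℕ) (hr : πBudY κ Φ t p D c mk g f ≤ r) :
    (((yL + crossOffY (nL κ Φ t p D g f) (ℓL κ Φ t p D g f) (hL κ Φ t p D g f) (vL κ Φ t p D g f) (sgOf du) (NrY κ Φ t p D g f P yL x du z)) 0).natAbs +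
        ((yL + crossOffY (nL κ Φ t p D g f) (ℓL κ Φ t p D g f) (hL κ Φ t p D g f) (vL κ Φ t p D g f) (sgOf du) (NrY κ Φ t p D g f P yL x du z)) 1).natAbs) +
      (N3WY κ Φ t p D g f P (yL + Skelφ.crossOffY (nL κ Φ t p D g f) (ℓL κ Φ t p D g f) (hL κ Φ t p D g f) (vL κ Φ t p D g f) (sgOf du) (NrY κ Φ t p D g f P yL x du z)) x du z (bwY κ Φ t p D g f) + 1) * shearUnit (nL κ Φ t p D g f) (hL κ Φ t p D g f) ≤ r := by
  have hu0 : 1 ≤ u₀A κ Φ t p D g f := (units_eqA κ Φ t p D g f).2.2.2.2.1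
  have hu1 : 1 ≤ u₁A κ Φ t p D g f := (units_eqA κ Φ t p D g f).2.2.2.2.2
  obtain ⟨-, hNr⟩ := NrY_range κ Φ t p D g f P hP x du hd z hj hlev1 hlev2 yL he1 (by linarith)
  have hσ : sgOf du = 1 ∨ sgOf du = -1 := sgOf_sign du
  have hR0 : (0 : ℤ) ≤ (KS0.R'0N κ Φ (KS.NQ Φ) t p D mk : ℤ) := by positivity
  obtain ⟨-, hNr600⟩ := NrY_range κ Φ t p D g f P hP x du hd z hj hlev1 hlev2 yL he1 (by linarith)
  have hNr'' : ((NrY κ Φ t p D g f P yL x du z : ℕ) : ℤ) + 1 ≤ 600 * (Neg.Kq κ : ℤ) := by exact_mod_cast hNr600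
  have hℓ'' : 22000 * (Neg.Kq κ : ℤ) * ((KS0.R'0N κ Φ (KS.NQ Φ) t p D mk : ℤ) + 2) ≤ (ℓL κ Φ t p D g f : ℤ) := by exact_mod_cast hℓA
  have hℓN : 25 * ((NrY κ Φ t p D g f P yL x du z : ℤ) + 1) + 13 ≤ (ℓL κ Φ t p D g f : ℤ) := by nlinarith
  have he0' : |FcA κ Φ t p D g f yL| ≤ 6 * u₀A κ Φ t p D g f := by linarith
  have hF := FcA_crossOffY_sub_abs_le κ Φ t p D g f hN hκ yL hσ (NrY κ Φ t p D g f P yL x du z) hℓN (by linarith)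
  have he6 : |FcA κ Φ t p D g f (yL + Skelφ.crossOffY (nL κ Φ t p D g f) (ℓL κ Φ t p D g f) (hL κ Φ t p D g f) (vL κ Φ t p D g f) (sgOf du) (NrY κ Φ t p D g f P yL x du z))| ≤ 6 * u₀A κ Φ t p D g f := by
    obtain ⟨a1, a2⟩ := abs_le.1 he0; obtain ⟨b1, b2⟩ := abs_le.1 hF; exact abs_le.2 ⟨by linarith, by linarith⟩
  have hbw2 := (bwY_eq κ Φ t p D g f).2
  have hFst : FcA κ Φ t p D g f (yL + Skelφ.crossOffY (nL κ Φ t p D g f) (ℓL κ Φ t p D g f) (hL κ Φ t p D g f) (vL κ Φ t p D g f) (sgOf du) (NrY κ Φ t p D g f P yL x du z)) + u₀A κ Φ t p D g f ≤ T0Y P x du z + (bwY κ Φ t p D g f) := by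
    obtain ⟨-, a2⟩ := abs_le.1 he6; linarith
  have hN3 := N3WY_range κ Φ t p D g f P hP (yL + Skelφ.crossOffY (nL κ Φ t p D g f) (ℓL κ Φ t p D g f) (hL κ Φ t p D g f) (vL κ Φ t p D g f) (sgOf du) (NrY κ Φ t p D g f P yL x du z)) x du hd z hz hkE he6 (by linarith) hbw2 hFst
  have hq := Neg.one_le_Kq κ
  have hNr' : NrY κ Φ t p D g f P yL x du z + 1 ≤ 1000 * Neg.Kq κ := by omega
  have hN3' : N3WY κ Φ t p D g f P (yL + Skelφ.crossOffY (nL κ Φ t p D g f) (ℓL κ Φ t p D g f) (hL κ Φ t p D g f) (vL κ Φ t p D g f) (sgOf du) (NrY κ Φ t p D g f P yL x du z)) x du z (bwY κ Φ t p D g f) + 1 ≤ 1000 * Neg.Kq κ := by omega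
  exact hπ3Y_YA_gen κ Φ t p D c mk g f hN hκ hℓA du yL hyl hNr' hN3' r hr

end KS

end NegB

end PlanarSkeletonFrmQuasi

end Summit.CriticalPhenomena.PercolationContinuityZ3.Theorems.Transplant

end
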